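import Literature.NumberTheory.Transcendental.KZCubeRationalMoves
import Literature.NumberTheory.Transcendental.BoxCoordinatePowerMap

/-!
# `ReductionRigidity` (stmt-KontsevichZagierPeriods-3407), line `Sketch`, stub `stub_islandComplement`:
# the first CROSS-LEVEL move in weight two — box duplication (`stub_boxDuplication`)

Route `KontsevichZagierPeriods/HermiteRigidity`, crux `ReductionRigidity` (stmt-3407); island-growth
deliverable G2 of `Cruxes/ReductionRigidity/STUB-PLAN-stub_islandComplement.md` for the remainder stub
`stub_islandComplement` (= item stmt-15935). The weight-two box islands of the line are LEVEL BY LEVEL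
(`[□², x^a y^b/(N − xy)^m]` for one `N`); the first relation of the Kontsevich–Zagier calculus that
connects DIFFERENT levels is the duplication formula of the dilogarithm,

  `Li₂(1/M²) = 2 Li₂(1/M) + 2 Li₂(−1/M)`, i.e.
  `[□², 1/(M² − xy)] − [□², 2/(M − xy)] + [□², 2/(M + xy)] ∈ KZ.relations`   (`stub_boxDuplication`),

realised by TWO moves on the closed square `□² = [0,1]²`: the change of variables along the squaring
self-map `Φ(x, y) = (x², y²)` of the cube (rule 2, `KZ.cubicalCovGens`, Jacobian `|det Φ'| = 4xy`;
the map is `BoxIntegral.coordPow 2` of `BoxCoordinatePowerMap.lean`), which turns `[□², 1/(M² − xy)]`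
into `[□², 4xy/(M² − x²y²)]`, followed by ONE integrand additivity (rule 1b) for the partial fraction
`4xy/(M² − x²y²) = 2/(M − xy) − 2/(M + xy)`. The squaring move is proved for regular rational
functions on the cube of any dimension (`rel_coordPow_two`), with no side condition.

References: M. Kontsevich, D. Zagier, *Periods* (2001), §1.2 rules (1), (2)
[cite: KontsevichZagier2001, §1.2]. No definitions are introduced.
-/

noncomputable section

open MeasureTheory Set MvPolynomial

namespace Summit.KontsevichZagierPeriods.HermiteRigidity.ReductionRigidity

open Literature.NumberTheory.Transcendental
open Literature.NumberTheory.Transcendental.KZ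
open Literature.ModelTheory.ExponentialFields (IsSemialgebraic)

/-! ## The squaring self-map of the closed cube -/

/-- The squaring map `x ↦ (xᵢ²)ᵢ` maps the closed unit cube ONTO itself (square roots).
[folklore] -/
theorem image_coordPow_two_cube (n : ℕ) : BoxIntegral.coordPow 2 '' cube n = cube n := by
  refine Subset.antisymm ?_ fun y hy => ?_
  · rintro _ ⟨x, hx, rfl⟩ i
    exact ⟨pow_nonneg (hx i).1 2, pow_le_one₀ (hx i).1 (hx i).2⟩
  · refine ⟨fun i => Real.sqrt (y i), fun i => ⟨Real.sqrt_nonneg _, Real.sqrt_le_one.2 (hy i).2⟩, ?_⟩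
    funext i
    rw [BoxIntegral.coordPow_apply, Real.sq_sqrt (hy i).1]

/-- The squaring map is a `ℚ`-semialgebraic map on the closed unit cube (it is the polynomial map
`(Xᵢ²)ᵢ`). [cite: BochnakCosteRoy1998, §2.2] -/
theorem isSemialgebraicMapOn_coordPow_two_cube (n : ℕ) :
    IsSemialgebraicMapOn ℚ (cube n) (BoxIntegral.coordPow (n := n) 2) := by
  refine (isSemialgebraicMapOn_aeval isSemialgebraic_cube
    (fun j => (X j : MvPolynomial (Fin n) ℚ) ^ 2)).congr fun x _ => ?_
  funext j
  simp [BoxIntegral.coordPow]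

/-- On the closed cube the Jacobian of the squaring map is `|det Φ'(x)| = 2ⁿ ∏ᵢ xᵢ ≥ 0`. [folklore] -/
theorem abs_det_coordPowDeriv_two {n : ℕ} {x : Fin n → ℝ} (hx : x ∈ cube n) :
    |(BoxIntegral.coordPowDeriv 2 x).det| = (2:ℝ) ^ n * ∏ i, x i := by
  rw [BoxIntegral.det_coordPowDeriv]
  have h : ∏ i, x i ^ (2 - 1) = ∏ i, x i := Finset.prod_congr rfl fun i _ => by norm_num
  rw [h]
  exact abs_of_nonneg (mul_nonneg (pow_nonneg zero_le_two n)
    (Finset.prod_nonneg fun i _ => (hx i).1))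

/-- **The squaring move on the closed cube** (rule 2 along the self-map `Φ(x) = (xᵢ²)ᵢ` of `[0,1]ⁿ`,
one generator of `KZ.cubicalCovGens`): for regular rational functions `R, W` on the cube with
`W(x) = R(x²) · 2ⁿ ∏ᵢ xᵢ` on `[0,1]ⁿ`, `[□ⁿ, W] − [□ⁿ, R] ∈ KZ.relations`. No side condition.
[cite: KontsevichZagier2001, §1.2 rule (2)] -/
theorem rel_coordPow_two {n : ℕ} (R W : RFun n)
    (h : ∀ x ∈ cube n, W.fn x = R.fn (BoxIntegral.coordPow 2 x) * ((2:ℝ) ^ n * ∏ i, x i)) :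
    KZ.of W.rep - KZ.of R.rep ∈ KZ.relations := by
  refine cubicalCovGens_subset_relations (mem_cubicalCovGens W.isTameCube_rep R.isTameCube_rep
    (Φ := BoxIntegral.coordPow 2) (Φ' := BoxIntegral.coordPowDeriv 2)
    (isSemialgebraicMapOn_coordPow_two_cube n)
    (fun x _ => BoxIntegral.hasFDerivWithinAt_coordPow 2 _ x)
    ((BoxIntegral.injOn_coordPow two_ne_zero).mono fun x hx i => (hx i).1)
    (image_coordPow_two_cube n) (fun i x _ => ?_) fun x hx => ?_)
  · show AnalyticAt ℝ (fun x : Fin n → ℝ => x i ^ 2) x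
    exact ((ContinuousLinearMap.proj (R := ℝ) (φ := fun _ : Fin n => ℝ) i).analyticAt x).pow 2
  · rw [RFun.rep_integrand, RFun.rep_integrand, h x hx, abs_det_coordPowDeriv_two hx]

/-! ## The four regular rational functions on `□²` -/

/-- On `□²`, `0 ≤ xy ≤ 1`. [folklore] -/
theorem mul_mem_Icc_of_mem_cube_two {x : Fin 2 → ℝ} (hx : x ∈ cube 2) :
    0 ≤ x 0 * x 1 ∧ x 0 * x 1 ≤ 1 :=
  ⟨mul_nonneg (hx 0).1 (hx 1).1, mul_le_one₀ (hx 0).2 (hx 1).1 (hx 1).2⟩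

/-- The integrands `1/(M² − xy)`, `4xy/(M² − x²y²)`, `2/(M − xy)`, `2/(M + xy)` (`M ≥ 2`) are regular
rational functions on `□²`: regular rational functions `R, W, S, T` with these values on the closed
square exist. [cite: KontsevichZagier2001, §1.1] -/
theorem exists_rfun_boxDuplication {M : ℕ} (hM : 2 ≤ M) :
    ∃ R W S T : RFun 2,
      (∀ x ∈ cube 2, R.fn x = 1 / ((M : ℝ) ^ 2 - x 0 * x 1)) ∧
      (∀ x ∈ cube 2, W.fn x = 4 * (x 0 * x 1) / ((M : ℝ) ^ 2 - x 0 ^ 2 * x 1 ^ 2)) ∧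
      (∀ x ∈ cube 2, S.fn x = 2 / ((M : ℝ) - x 0 * x 1)) ∧
      (∀ x ∈ cube 2, T.fn x = 2 / ((M : ℝ) + x 0 * x 1)) := by
  have h2 : (2:ℝ) ≤ (M:ℝ) := by exact_mod_cast hM
  have hR : ∀ x ∈ cube 2, aeval x (C ((M:ℚ) ^ 2) - X 0 * X 1 : MvPolynomial (Fin 2) ℚ) ≠ 0 := by
    intro x hx
    have := mul_mem_Icc_of_mem_cube_two hx
    simp only [map_sub, map_mul, map_pow, aeval_C, aeval_X, eq_ratCast, Rat.cast_natCast]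
    nlinarith
  have hW : ∀ x ∈ cube 2,
      aeval x (C ((M:ℚ) ^ 2) - X 0 ^ 2 * X 1 ^ 2 : MvPolynomial (Fin 2) ℚ) ≠ 0 := by
    intro x hx
    have := mul_mem_Icc_of_mem_cube_two hx
    simp only [map_sub, map_mul, map_pow, aeval_C, aeval_X, eq_ratCast, Rat.cast_natCast]
    nlinarith
  have hS : ∀ x ∈ cube 2, aeval x (C (M:ℚ) - X 0 * X 1 : MvPolynomial (Fin 2) ℚ) ≠ 0 := by
    intro x hx
    have := mul_mem_Icc_of_mem_cube_two hx
    simp only [map_sub, map_mul, aeval_C, aeval_X, eq_ratCast, Rat.cast_natCast]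
    nlinarith
  have hT : ∀ x ∈ cube 2, aeval x (C (M:ℚ) + X 0 * X 1 : MvPolynomial (Fin 2) ℚ) ≠ 0 := by
    intro x hx
    have := mul_mem_Icc_of_mem_cube_two hx
    simp only [map_add, map_mul, aeval_C, aeval_X, eq_ratCast, Rat.cast_natCast]
    nlinarith
  refine ⟨⟨1, _, hR⟩, ⟨C 4 * X 0 * X 1, _, hW⟩, ⟨C 2, _, hS⟩, ⟨C 2, _, hT⟩,
    fun x _ => ?_, fun x _ => ?_, fun x _ => ?_, fun x _ => ?_⟩ <;>
  simp [RFun.fn_apply, mul_assoc]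

/-! ## The registered sub-goal stub -/

/-- **Stub `stub_boxDuplication`** (sub-goal of crux `ReductionRigidity`, stmt-3407, line `Sketch`,
growth deliverable G2 for the remainder stub `stub_islandComplement`): **the duplication formula of the
dilogarithm as a chain of two moves**, for every integer `M ≥ 2` and any representations `r, s, t` on
the closed square with the printed integrands on it:
`[□², 1/(M² − xy)] − [□², 2/(M − xy)] + [□², 2/(M + xy)] ∈ KZ.relations`
(values `Li₂(1/M²)`, `2Li₂(1/M)`, `−2Li₂(−1/M)`). Moves: the squaring change of variables
(`rel_coordPow_two`: `[□², 1/(M² − xy)] ≡ [□², 4xy/(M² − x²y²)]`) and one integrand additivity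
(`4xy/(M² − x²y²) = 2/(M − xy) − 2/(M + xy)`); the quantified representations are bridged to the
cube representations by congruence. [cite: KontsevichZagier2001, §1.2 rules (1), (2)] -/
theorem stub_boxDuplication :
    ∀ (M : ℕ), 2 ≤ M → ∀ (r s t : IntegralRep 2),
      r.domain = cube 2 → EqOn r.integrand (fun p => 1 / ((M : ℝ) ^ 2 - p 0 * p 1)) (cube 2) →
      s.domain = cube 2 → EqOn s.integrand (fun p => 2 / ((M : ℝ) - p 0 * p 1)) (cube 2) →
      t.domain = cube 2 → EqOn t.integrand (fun p => 2 / ((M : ℝ) + p 0 * p 1)) (cube 2) →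
      KZ.of r - KZ.of s + KZ.of t ∈ KZ.relations := by
  intro M hM r s t hr hri hs hsi ht hti
  have h2 : (2:ℝ) ≤ (M:ℝ) := by exact_mod_cast hM
  obtain ⟨R, W, S, T, hR, hW, hS, hT⟩ := exists_rfun_boxDuplication hM
  -- congruences with the cube representations
  have er : KZ.of r - KZ.of R.rep ∈ KZ.relations :=
    KZ.of_sub_of_mem_relations_of_eqOn (by rw [hr]; rfl) fun x hx => by
      rw [hr] at hx; rw [hri hx]; exact (hR x hx).symm
  have es : KZ.of s - KZ.of S.rep ∈ KZ.relations :=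
    KZ.of_sub_of_mem_relations_of_eqOn (by rw [hs]; rfl) fun x hx => by
      rw [hs] at hx; rw [hsi hx]; exact (hS x hx).symm
  have et : KZ.of t - KZ.of T.rep ∈ KZ.relations :=
    KZ.of_sub_of_mem_relations_of_eqOn (by rw [ht]; rfl) fun x hx => by
      rw [ht] at hx; rw [hti hx]; exact (hT x hx).symm
  -- the squaring move `[W] ≡ [R]`
  have eWR : KZ.of W.rep - KZ.of R.rep ∈ KZ.relations := by
    refine rel_coordPow_two R W fun x hx => ?_
    have hx2 : BoxIntegral.coordPow 2 x ∈ cube 2 := by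
      rw [← image_coordPow_two_cube 2]; exact mem_image_of_mem _ hx
    rw [hW x hx, hR _ hx2, Fin.prod_univ_two, BoxIntegral.coordPow_apply,
      BoxIntegral.coordPow_apply]
    ring
  -- the partial fraction `[W] ≡ [S] − [T]`
  have eWST : KZ.of W.rep - KZ.of (S.sub T).rep ∈ KZ.relations := by
    refine RFun.rel_of_eqOn fun x hx => ?_
    have hxy := mul_mem_Icc_of_mem_cube_two hx
    have hm : (M:ℝ) - x 0 * x 1 ≠ 0 := by nlinarith
    have hp : (M:ℝ) + x 0 * x 1 ≠ 0 := by nlinarith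
    rw [RFun.fn_sub hx, hW x hx, hS x hx, hT x hx]
    have hsq : (M:ℝ) ^ 2 - x 0 ^ 2 * x 1 ^ 2 = ((M:ℝ) - x 0 * x 1) * ((M:ℝ) + x 0 * x 1) := by ring
    rw [hsq]
    field_simp
    ring
  have eST := RFun.rel_sub S T
  have : KZ.of r - KZ.of s + KZ.of t =
      (KZ.of r - KZ.of R.rep) - (KZ.of W.rep - KZ.of R.rep) + (KZ.of W.rep - KZ.of (S.sub T).rep)
        + (KZ.of (S.sub T).rep - (KZ.of S.rep - KZ.of T.rep))
        - (KZ.of s - KZ.of S.rep) + (KZ.of t - KZ.of T.rep) := by abel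
  rw [this]
  exact KZ.relations.add_mem (KZ.relations.sub_mem (KZ.relations.add_mem
    (KZ.relations.add_mem (KZ.relations.sub_mem er eWR) eWST) eST) es) et

end Summit.KontsevichZagierPeriods.HermiteRigidity.ReductionRigidity

end
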